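import Mathlib
import Literature.Analysis.Complex.KthRootChart
import Literature.Geometry.Symplectic.JHolomorphicLeadingTerm
import Literature.Geometry.Symplectic.JHolomorphicLeadingTermChart
import HarnessLib

/-!
# The `(zᵏ, û(z))` normal form of a `J`-holomorphic curve in dimension four (Wendl 2020, Thm B.23, first half)

Let `F` be a real normed space of dimension `4`, `J` a smooth almost complex structure on an open
`U ⊆ F`, and `u : B(z₀,R) → U` a smooth `J`-holomorphic curve, not locally constant at `z₀`.
**`jHolomorphic_kthRootNormalForm`**: there are `k ≥ 1`, a smooth chart `Θ` of `F` about
`u(z₀)` onto an open subset of `ℂ × ℂ` (with smooth inverse, `Θ(u(z₀)) = 0`), a local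
homeomorphism `ξ` of `ℂ` about `z₀` which is `C¹` with `C¹` inverse and `C^∞` off `z₀`
(`ξ(z₀) = 0`), and a `C¹` map `û` with `û(w) = O(|w|^{k+1})`, such that

  `Θ(u(z)) = (ξ(z)ᵏ, û(ξ(z)))`   near `z₀`;

i.e. `u ∘ ξ⁻¹ (w) = Θ⁻¹(wᵏ, û(w))` — the first assertion of the local representation formula
(Wendl 2020, App. B, Thm B.23: "`u(z) = (zᵏ, û(z))`, `û = O(|z|^{k+1})`, in a `C^∞` chart near
`u(z₀)` and a `C¹` chart near `z₀`, `C^∞` away from `z₀`"; Micallef–White 1995). Here the chart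
`Θ` is AFFINE (`Θ = A ∘ Φ ∘ (· - u(z₀))`, `Φ` linear with `Φ J(u(z₀)) = iΦ`, `A` complex-linear
with `A b = (1, 0)` for the leading coefficient `b`); the statement is exactly the first block of
conclusions of the rotation form of the representation formula used for
`Literature.Geometry.Symplectic.jHolomorphic_localBranchDichotomy`
(`Literature/Geometry/Symplectic/JHolomorphicLocalBranchDichotomy.lean`), whose remaining
assertion (the expansion of `û(e^{2πiℓ/k}w) - û(w)`) needs a chart adapted to `J` along an axis
(Wendl 2020, §B.2.3–B.2.5).

Assembly (`normalForm_of_chart`, stated for an arbitrary smooth chart `Θ₀` with complex-linear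
differential at `u(z₀)` so that it can be re-run with `J`-adapted charts): leading term
`Θ₀(u(z₀ + z)) = zᵏ • b + R(z)` (`Literature.Geometry.Symplectic.jHolomorphic_leadingTerm_chart`),
a complex-linear `A : ℂ² ≃ ℂ × ℂ` with `A b = (1,0)` (`exists_equiv_prod_apply_eq`), and the `C¹`
`k`-th root chart of `Literature/Analysis/Complex/KthRootChart.lean` applied to the components of
`A ∘ Θ₀ ∘ u(z₀ + ·) = (zᵏ + R₁, R₂)`.

Everything is proved; no named facts.

## References

* C. Wendl, *Lectures on Contact 3-Manifolds, Holomorphic Curves and Intersection Theory*,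
  Cambridge Tracts in Math. 220 (2020), App. B, Thm B.23 and §B.2.3 (Lemma B.29). [Wendl2020]
* M. Micallef, B. White, *The structure of branch points in minimal surfaces and in
  pseudoholomorphic curves*, Ann. of Math. 141 (1995), Thm 6.1. [MicallefWhite1995]
* D. McDuff, D. Salamon, *J-holomorphic curves and symplectic topology*, 2nd ed. (2012), §2.3,
  App. E. [McDuffSalamon2012]
-/

noncomputable section


open scoped ContDiff Topology
open Set Filter Metric Function Complex Asymptotics

namespace Literature.Geometry.Symplectic

open Literature.Analysis.Complex Literature.Analysis.Complex.KthRootChart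

/-! ### Linear algebra: a complex-linear `A : ℂ² ≃ ℂ × ℂ` with `A b = (1, 0)` -/

/-- For `b ≠ 0` in `ℂ²` there is a complex-linear homeomorphism `A : ℂ² ≃ ℂ × ℂ` with
`A b = (1, 0)`. [folklore] -/
theorem exists_equiv_prod_apply_eq {b : EuclideanSpace ℂ (Fin 2)} (hb : b ≠ 0) :
    ∃ A : EuclideanSpace ℂ (Fin 2) ≃L[ℂ] ℂ × ℂ, A b = (1, 0) := by
  have hrank : Module.finrank ℂ (EuclideanSpace ℂ (Fin 2)) = 2 := by simp
  obtain ⟨c, hbc⟩ := exists_linearIndependent_pair_of_one_lt_finrank (by rw [hrank]; norm_num) hb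
  have hcard : Fintype.card (Fin 2) = Module.finrank ℂ (EuclideanSpace ℂ (Fin 2)) := by
    rw [hrank]; simp
  let B : Module.Basis (Fin 2) ℂ (EuclideanSpace ℂ (Fin 2)) :=
    basisOfLinearIndependentOfCardEqFinrank hbc hcard
  have hB0 : B 0 = b := by
    simp [B, basisOfLinearIndependentOfCardEqFinrank]
  let A₀ : EuclideanSpace ℂ (Fin 2) ≃ₗ[ℂ] ℂ × ℂ :=
    B.equivFun.trans (LinearEquiv.finTwoArrow ℂ ℂ)
  refine ⟨A₀.toContinuousLinearEquiv, ?_⟩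
  show A₀ b = (1, 0)
  have h1 : B.equivFun b = Pi.single (0 : Fin 2) (1 : ℂ) := by
    funext j
    rw [← hB0, Module.Basis.equivFun_self]
    fin_cases j <;> simp
  simp [A₀, LinearEquiv.trans_apply, h1, LinearEquiv.finTwoArrow]

/-! ### Assembly from a chart with complex-linear differential at the base point -/

/-- **Normal form from a chart.** Let `u` be smooth on `B(z₀,ρ)` with values in the source of a
smooth chart `Θ₀ : F → ℂ²` (smooth inverse, `Θ₀(u z₀) = 0`), and suppose
`Θ₀(u(z₀ + z)) = zᵏ • b + R(z)` with `‖R‖ ≤ C|z|^{k+1}`, `‖DR‖ ≤ C|z|^k` (`k ≥ 1`), and let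
`A : ℂ² ≃ ℂ × ℂ` be complex-linear with `A b = (1, 0)`. Then for the chart `Θ = A ∘ Θ₀` there are
a `C¹` local homeomorphism `ξ` at `z₀` (`C¹` inverse, `C^∞` off `z₀`, `ξ z₀ = 0`) and a `C¹` map
`û = O(|w|^{k+1})` with `Θ(u z) = (ξ(z)ᵏ, û(ξ z))` near `z₀`.
[cite: Wendl2020, App. B, Thm B.23 and §B.2.3 (Lemma B.29)] -/
theorem normalForm_of_chart {F : Type*} [NormedAddCommGroup F] [NormedSpace ℝ F]
    {u : ℂ → F} {z₀ : ℂ} {ρ : ℝ} (hρ : 0 < ρ) (hu : ContDiffOn ℝ ∞ u (ball z₀ ρ))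
    (Θ₀ : OpenPartialHomeomorph F (EuclideanSpace ℂ (Fin 2)))
    (hus : MapsTo u (ball z₀ ρ) Θ₀.source) (hΘ0 : Θ₀ (u z₀) = 0)
    (hΘ : ContDiffOn ℝ ∞ Θ₀ Θ₀.source) (hΘsymm : ContDiffOn ℝ ∞ Θ₀.symm Θ₀.target)
    {k : ℕ} (hk : 0 < k) {b : EuclideanSpace ℂ (Fin 2)} {C : ℝ}
    (hb1 : ∀ z ∈ ball (0 : ℂ) ρ, ‖Θ₀ (u (z₀ + z)) - z ^ k • b‖ ≤ C * ‖z‖ ^ (k + 1))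
    (hb2 : ∀ z ∈ ball (0 : ℂ) ρ,
      ‖fderiv ℝ (fun z => Θ₀ (u (z₀ + z)) - z ^ k • b) z‖ ≤ C * ‖z‖ ^ k)
    (A : EuclideanSpace ℂ (Fin 2) ≃L[ℂ] ℂ × ℂ) (hA : A b = (1, 0)) :
    ∃ (Θ : OpenPartialHomeomorph F (ℂ × ℂ)) (ξ : OpenPartialHomeomorph ℂ ℂ) (uhat : ℂ → ℂ)
      (ρ' ρ₁ : ℝ), Θ = Θ₀.transHomeomorph (A : EuclideanSpace ℂ (Fin 2) ≃ₜ ℂ × ℂ) ∧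
      0 < ρ' ∧ 0 < ρ₁ ∧
      u z₀ ∈ Θ.source ∧ Θ (u z₀) = 0 ∧ ContDiffOn ℝ ∞ Θ Θ.source ∧
        ContDiffOn ℝ ∞ Θ.symm Θ.target ∧
      ball z₀ ρ' ⊆ ξ.source ∧ ξ z₀ = 0 ∧ ContDiffOn ℝ 1 ξ ξ.source ∧
        ContDiffOn ℝ 1 ξ.symm ξ.target ∧ ContDiffOn ℝ ∞ ξ (ξ.source \ {z₀}) ∧
      MapsTo ξ (ball z₀ ρ') (ball 0 ρ₁) ∧ ContDiffOn ℝ 1 uhat (ball 0 ρ₁) ∧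
        (uhat =O[𝓝 0] fun w : ℂ => ‖w‖ ^ (k + 1)) ∧
        (∀ z ∈ ball z₀ ρ', u z ∈ Θ.source ∧ Θ (u z) = ((ξ z) ^ k, uhat (ξ z))) := by
  set Θ := Θ₀.transHomeomorph (A : EuclideanSpace ℂ (Fin 2) ≃ₜ ℂ × ℂ) with hΘ_def
  -- the real-linear map underlying `A`
  set Aℝ : EuclideanSpace ℂ (Fin 2) →L[ℝ] ℂ × ℂ :=
    (A : EuclideanSpace ℂ (Fin 2) →L[ℂ] ℂ × ℂ).restrictScalars ℝ with hAℝ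
  have hAℝ_apply : ∀ x, Aℝ x = A x := fun x => rfl
  have hAcont : ContDiff ℝ ∞ (fun x : EuclideanSpace ℂ (Fin 2) => A x) := Aℝ.contDiff
  have hAsymmcont : ContDiff ℝ ∞ (fun x : ℂ × ℂ => A.symm x) :=
    ((A.symm : ℂ × ℂ →L[ℂ] EuclideanSpace ℂ (Fin 2)).restrictScalars ℝ).contDiff
  -- chart facts
  have hΘsrc : Θ.source = Θ₀.source := rfl
  have hΘapply : ∀ x, Θ x = A (Θ₀ x) := fun x => rfl
  have hΘsymm_apply : ∀ y, Θ.symm y = Θ₀.symm (A.symm y) := fun y => rfl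
  have hΘtgt : ∀ y, y ∈ Θ.target ↔ A.symm y ∈ Θ₀.target := fun y => Iff.rfl
  have hz₀ : z₀ ∈ ball z₀ ρ := mem_ball_self hρ
  have hp : u z₀ ∈ Θ.source := hus hz₀
  have hΘp : Θ (u z₀) = 0 := by rw [hΘapply, hΘ0, map_zero]
  have hΘsmooth : ContDiffOn ℝ ∞ Θ Θ.source := by
    rw [hΘsrc]; exact hAcont.comp_contDiffOn hΘ
  have hΘsymm_smooth : ContDiffOn ℝ ∞ Θ.symm Θ.target := by
    have : (Θ.symm : ℂ × ℂ → F) = Θ₀.symm ∘ fun y => A.symm y := rfl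
    rw [this]
    exact hΘsymm.comp hAsymmcont.contDiffOn fun y hy => (hΘtgt y).1 hy
  -- the components of `Θ ∘ u ∘ (z₀ + ·)` and the remainder
  set Rm : ℂ → EuclideanSpace ℂ (Fin 2) := fun z => Θ₀ (u (z₀ + z)) - z ^ k • b with hRm
  set g₁ : ℂ → ℂ := fun z => (A (Θ₀ (u (z₀ + z)))).1 with hg₁
  set g₂ : ℂ → ℂ := fun z => (A (Θ₀ (u (z₀ + z)))).2 with hg₂
  have hsplit : ∀ z, A (Θ₀ (u (z₀ + z))) = ((z ^ k : ℂ), (0 : ℂ)) + A (Rm z) := by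
    intro z
    have : Θ₀ (u (z₀ + z)) = z ^ k • b + Rm z := by simp [hRm]
    rw [this, map_add, A.map_smul, hA, Prod.smul_mk, smul_eq_mul, mul_one, smul_zero]
  have hg₁R : ∀ z, g₁ z - z ^ k = (A (Rm z)).1 := by
    intro z; simp only [hg₁, hsplit z, Prod.fst_add]; ring
  have hg₂R : ∀ z, g₂ z = (A (Rm z)).2 := by
    intro z; simp only [hg₂, hsplit z, Prod.snd_add, zero_add]
  -- smoothness on the ball
  have hball : ∀ {r : ℝ} {z : ℂ}, z ∈ ball (0 : ℂ) r → z₀ + z ∈ ball z₀ r := by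
    intro r z hz; simpa [mem_ball, dist_eq_norm] using hz
  have hut : ContDiffOn ℝ ∞ (fun z : ℂ => u (z₀ + z)) (ball (0 : ℂ) ρ) :=
    hu.comp (contDiff_const.add contDiff_id).contDiffOn fun z hz => hball hz
  have hh : ContDiffOn ℝ ∞ (fun z => Θ₀ (u (z₀ + z))) (ball (0 : ℂ) ρ) :=
    hΘ.comp hut fun z hz => hus (hball hz)
  have hRmdiff : ContDiffOn ℝ ∞ Rm (ball (0 : ℂ) ρ) :=
    hh.sub ((contDiff_id.pow k).smul contDiff_const).contDiffOn
  have hAh : ContDiffOn ℝ ∞ (fun z => A (Θ₀ (u (z₀ + z)))) (ball (0 : ℂ) ρ) :=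
    hAcont.comp_contDiffOn hh
  have hg₁diff : ContDiffOn ℝ ∞ g₁ (ball (0 : ℂ) ρ) := contDiff_fst.comp_contDiffOn hAh
  have hg₂diff : ContDiffOn ℝ ∞ g₂ (ball (0 : ℂ) ρ) := contDiff_snd.comp_contDiffOn hAh
  -- the bounds for the `k`-th root chart
  set C₁ : ℝ := ‖Aℝ‖ * max C 0 with hC₁
  have hC₁0 : 0 ≤ C₁ := by positivity
  have hRm1 : ∀ z ∈ ball (0 : ℂ) ρ, ‖A (Rm z)‖ ≤ C₁ * ‖z‖ ^ (k + 1) := by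
    intro z hz
    calc ‖A (Rm z)‖ = ‖Aℝ (Rm z)‖ := rfl
      _ ≤ ‖Aℝ‖ * ‖Rm z‖ := Aℝ.le_opNorm _
      _ ≤ ‖Aℝ‖ * (max C 0 * ‖z‖ ^ (k + 1)) := by
          gcongr
          exact (hb1 z hz).trans (by gcongr; exact le_max_left _ _)
      _ = C₁ * ‖z‖ ^ (k + 1) := by rw [hC₁]; ring
  have hRm2 : ∀ z ∈ ball (0 : ℂ) ρ, ∀ (L : ℂ × ℂ →L[ℝ] ℂ), ‖L‖ ≤ 1 →
      ‖fderiv ℝ (fun z => L (A (Rm z))) z‖ ≤ C₁ * ‖z‖ ^ k := by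
    intro z hz L hL
    have hd : DifferentiableAt ℝ Rm z :=
      (hRmdiff.differentiableOn (by simp)).differentiableAt (isOpen_ball.mem_nhds hz)
    have : (fun z => L (A (Rm z))) = (L.comp Aℝ) ∘ Rm := rfl
    rw [this, ((L.comp Aℝ).hasFDerivAt.comp z hd.hasFDerivAt).fderiv]
    calc ‖(L.comp Aℝ).comp (fderiv ℝ Rm z)‖ ≤ ‖L.comp Aℝ‖ * ‖fderiv ℝ Rm z‖ :=
          ContinuousLinearMap.opNorm_comp_le _ _
      _ ≤ (‖L‖ * ‖Aℝ‖) * (max C 0 * ‖z‖ ^ k) := by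
          gcongr
          · exact ContinuousLinearMap.opNorm_comp_le _ _
          · exact (hb2 z hz).trans (by gcongr; exact le_max_left _ _)
      _ ≤ (1 * ‖Aℝ‖) * (max C 0 * ‖z‖ ^ k) := by gcongr
      _ = C₁ * ‖z‖ ^ k := by rw [hC₁]; ring
  have hR₁ : ∀ z ∈ ball (0 : ℂ) ρ, ‖g₁ z - z ^ k‖ ≤ C₁ * ‖z‖ ^ (k + 1) := fun z hz => by
    rw [hg₁R]; exact (norm_fst_le _).trans (hRm1 z hz)
  have hR₂ : ∀ z ∈ ball (0 : ℂ) ρ, ‖g₂ z‖ ≤ C₁ * ‖z‖ ^ (k + 1) := fun z hz => by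
    rw [hg₂R]; exact (norm_snd_le _).trans (hRm1 z hz)
  have hDR₁ : ∀ z ∈ ball (0 : ℂ) ρ, ‖fderiv ℝ (fun z => g₁ z - z ^ k) z‖ ≤ C₁ * ‖z‖ ^ k := by
    intro z hz
    have : (fun z => g₁ z - z ^ k) = fun z => (ContinuousLinearMap.fst ℝ ℂ ℂ) (A (Rm z)) := by
      funext z; rw [hg₁R]; rfl
    rw [this]
    exact hRm2 z hz _ (ContinuousLinearMap.norm_fst_le ℝ ℂ ℂ)
  have hDR₂ : ∀ z ∈ ball (0 : ℂ) ρ, ‖fderiv ℝ g₂ z‖ ≤ C₁ * ‖z‖ ^ k := by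
    intro z hz
    have : g₂ = fun z => (ContinuousLinearMap.snd ℝ ℂ ℂ) (A (Rm z)) := by
      funext z; rw [hg₂R]; rfl
    rw [this]
    exact hRm2 z hz _ (ContinuousLinearMap.norm_snd_le ℝ ℂ ℂ)
  -- the `k`-th root chart at `0`
  obtain ⟨ξ, ρξ, ρ₁, C', hρξ, hρ₁, hsrc, htgt, hξ0, -, hξC1, hξsymmC1, hξsmooth, hmaps, hpow,
    huhatC1, huhat1, -, hg₂uhat⟩ :=
    exists_kthRootChart (G := ℂ) hk.ne' hρ hC₁0 hg₁diff hg₂diff hR₁ hDR₁ hR₂ hDR₂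
  -- translate to `z₀`
  set τ : ℂ ≃ₜ ℂ := Homeomorph.addRight (-z₀) with hτ
  set ξX : OpenPartialHomeomorph ℂ ℂ := τ.transOpenPartialHomeomorph ξ with hξX
  have hξX_apply : ∀ z, ξX z = ξ (z + -z₀) := fun z => rfl
  have hξX_symm : ∀ w, ξX.symm w = ξ.symm w + z₀ := fun w => by
    show ξ.symm w + -(-z₀) = _
    rw [neg_neg]
  have hξX_src : ∀ z, z ∈ ξX.source ↔ z + -z₀ ∈ ξ.source := fun z => Iff.rfl
  have hξX_tgt : ξX.target = ξ.target := rfl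
  set ρ' : ℝ := min ρξ ρ with hρ'
  have hρ'0 : 0 < ρ' := lt_min hρξ hρ
  have hshift : ∀ {z : ℂ}, z ∈ ball z₀ ρ' → z + -z₀ ∈ ball (0 : ℂ) ρξ ∧ z + -z₀ ∈ ball (0 : ℂ) ρ := by
    intro z hz
    have : ‖z + -z₀‖ < ρ' := by simpa [mem_ball, dist_eq_norm, ← sub_eq_add_neg] using hz
    exact ⟨by simpa using this.trans_le (min_le_left _ _),
      by simpa using this.trans_le (min_le_right _ _)⟩
  set uhat : ℂ → ℂ := g₂ ∘ ξ.symm with huhat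
  refine ⟨Θ, ξX, uhat, ρ', ρ₁, rfl, hρ'0, hρ₁, hp, hΘp, hΘsmooth, hΘsymm_smooth, ?_, ?_, ?_, ?_, ?_,
    ?_, huhatC1, ?_, ?_⟩
  · -- `ball z₀ ρ' ⊆ ξX.source`
    intro z hz; rw [hξX_src]; exact hsrc (hshift hz).1
  · -- `ξX z₀ = 0`
    rw [hξX_apply, add_neg_cancel, hξ0]
  · -- `C¹`
    exact hξC1.comp (contDiff_id.add contDiff_const).contDiffOn fun z hz => hz
  · -- inverse `C¹`
    rw [hξX_tgt]
    have : (ξX.symm : ℂ → ℂ) = fun w => ξ.symm w + z₀ := funext hξX_symm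
    rw [this]
    exact hξsymmC1.add contDiffOn_const
  · -- smooth off `z₀`
    refine hξsmooth.comp (contDiff_id.add contDiff_const).contDiffOn fun z hz => ⟨hz.1, ?_⟩
    have hne : z ≠ z₀ := hz.2
    show z + -z₀ ∉ ({0} : Set ℂ)
    rw [mem_singleton_iff, add_neg_eq_zero]; exact hne
  · -- maps the ball into `ball 0 ρ₁`
    intro z hz; rw [hξX_apply]; exact hmaps (hshift hz).1
  · -- `û = O(|w|^{k+1})`
    refine IsBigO.of_bound C' ?_
    filter_upwards [ball_mem_nhds (0 : ℂ) hρ₁] with w hw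
    rw [Real.norm_of_nonneg (by positivity)]
    exact huhat1 w hw
  · -- the normal form
    intro z hz
    refine ⟨hus (ball_subset_ball (min_le_right _ _) hz), ?_⟩
    obtain ⟨h1, h2⟩ := hshift hz
    have hz' : z₀ + (z + -z₀) = z := by ring
    rw [hΘapply, hξX_apply]
    have := hsplit (z + -z₀)
    rw [hz'] at this
    rw [Prod.ext_iff]
    refine ⟨?_, ?_⟩
    · show (A (Θ₀ (u z))).1 = ξ (z + -z₀) ^ k
      rw [hpow _ h1]; simp only [hg₁, hz']
    · show (A (Θ₀ (u z))).2 = uhat (ξ (z + -z₀))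
      rw [← hg₂uhat _ h1]; simp only [hg₂, hz']

/-! ### The normal form in linear coordinates -/

/-- **The `(zᵏ, û(z))` normal form of a `J`-holomorphic curve in dimension four** (Wendl 2020,
Thm B.23, first assertion, with an affine chart on the target). See the module docstring.
[cite: Wendl2020, App. B, Thm B.23; MicallefWhite1995, Thm 6.1] -/
theorem jHolomorphic_kthRootNormalForm (F : Type) [NormedAddCommGroup F] [NormedSpace ℝ F]
    [FiniteDimensional ℝ F] (hF : Module.finrank ℝ F = 4)
    (J : F → F →L[ℝ] F) (U : Set F) (hU : IsOpen U) (hJ : ContDiffOn ℝ ∞ J U)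
    (hJ2 : ∀ x ∈ U, ∀ v : F, J x (J x v) = -v)
    (u : ℂ → F) (z₀ : ℂ) (R : ℝ) (hR : 0 < R) (hu : ContDiffOn ℝ ∞ u (ball z₀ R))
    (huU : MapsTo u (ball z₀ R) U)
    (hhol : ∀ z ∈ ball z₀ R, ∀ α : ℂ, fderiv ℝ u z (Complex.I * α) = J (u z) (fderiv ℝ u z α))
    (hnc : ∃ᶠ z in 𝓝 z₀, u z ≠ u z₀) :
    ∃ (k : ℕ) (Θ : OpenPartialHomeomorph F (ℂ × ℂ)) (ξ : OpenPartialHomeomorph ℂ ℂ)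
      (uhat : ℂ → ℂ) (ρ ρ₁ : ℝ),
      0 < k ∧ 0 < ρ ∧ 0 < ρ₁ ∧
      u z₀ ∈ Θ.source ∧ Θ (u z₀) = 0 ∧ ContDiffOn ℝ ∞ Θ Θ.source ∧
        ContDiffOn ℝ ∞ Θ.symm Θ.target ∧
      ball z₀ ρ ⊆ ξ.source ∧ ξ z₀ = 0 ∧ ContDiffOn ℝ 1 ξ ξ.source ∧
        ContDiffOn ℝ 1 ξ.symm ξ.target ∧ ContDiffOn ℝ ∞ ξ (ξ.source \ {z₀}) ∧
      MapsTo ξ (ball z₀ ρ) (ball 0 ρ₁) ∧ ContDiffOn ℝ 1 uhat (ball 0 ρ₁) ∧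
        (uhat =O[𝓝 0] fun w : ℂ => ‖w‖ ^ (k + 1)) ∧
        (∀ z ∈ ball z₀ ρ, u z ∈ Θ.source ∧ Θ (u z) = ((ξ z) ^ k, uhat (ξ z))) := by
  haveI : CompleteSpace F := FiniteDimensional.complete ℝ F
  set p : F := u z₀ with hp
  have hpU : p ∈ U := huU (mem_ball_self hR)
  have hJ₀2 : ∀ v, J p (J p v) = -v := hJ2 p hpU
  obtain ⟨Φ, hΦJ⟩ := exists_equiv_euclidean_of_complexStructure (n := 2) (by rw [hF]) (J p) hJ₀2
  -- the affine chart `Θ₀ x = Φ (x - p)`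
  set σ : F ≃ₜ F := Homeomorph.addRight (-p) with hσ
  set Θ₀ : OpenPartialHomeomorph F (EuclideanSpace ℂ (Fin 2)) :=
    (σ.trans (Φ : F ≃ₜ EuclideanSpace ℂ (Fin 2))).toOpenPartialHomeomorph with hΘ₀
  have hΘ₀_apply : ∀ x, Θ₀ x = Φ (x + -p) := fun x => rfl
  have hΘ₀_src : Θ₀.source = univ := rfl
  have hΘ₀_tgt : Θ₀.target = univ := rfl
  have hΘ₀_symm : ∀ y, Θ₀.symm y = Φ.symm y + p := fun y => by
    show Φ.symm y + -(-p) = _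
    rw [neg_neg]
  have hΘ₀p : Θ₀ p = 0 := by rw [hΘ₀_apply, add_neg_cancel, map_zero]
  have hΘ₀smooth : ContDiffOn ℝ ∞ Θ₀ Θ₀.source := by
    have : (Θ₀ : F → EuclideanSpace ℂ (Fin 2)) = fun x => Φ (x + -p) := rfl
    rw [this]
    exact (Φ.contDiff.comp (contDiff_id.add contDiff_const)).contDiffOn
  have hΘ₀symm_smooth : ContDiffOn ℝ ∞ Θ₀.symm Θ₀.target := by
    have : (Θ₀.symm : EuclideanSpace ℂ (Fin 2) → F) = fun y => Φ.symm y + p := funext hΘ₀_symm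
    rw [this]
    exact (Φ.symm.contDiff.add contDiff_const).contDiffOn
  have hfdΘ₀ : fderiv ℝ Θ₀ p = (Φ : F →L[ℝ] EuclideanSpace ℂ (Fin 2)) := by
    have : (Θ₀ : F → EuclideanSpace ℂ (Fin 2)) = fun x => Φ (x + -p) := rfl
    rw [this]
    exact ((Φ : F →L[ℝ] EuclideanSpace ℂ (Fin 2)).hasFDerivAt.comp p
      ((hasFDerivAt_id p).add_const (-p))).fderiv
  have hlin : ∀ v, fderiv ℝ Θ₀ (u z₀) (J (u z₀) v) = I • fderiv ℝ Θ₀ (u z₀) v := by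
    intro v; rw [← hp, hfdΘ₀]; exact hΦJ v
  have hhol1 : ∀ z ∈ ball z₀ R, fderiv ℝ u z I = J (u z) (fderiv ℝ u z 1) := fun z hz => by
    simpa using hhol z hz 1
  obtain ⟨k, b, C, ρ, hk, hb, hρ, hρR, hus, hb1, hb2⟩ :=
    jHolomorphic_leadingTerm_chart hU (hJ.of_le (by norm_cast)) hR hu huU hhol1 hnc Θ₀
      (by rw [hΘ₀_src]; exact mem_univ _) hΘ₀p hΘ₀smooth (hΘ₀symm_smooth.of_le (by norm_cast)) hlin
  obtain ⟨A, hA⟩ := exists_equiv_prod_apply_eq hb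
  obtain ⟨Θ, ξ, uhat, ρ', ρ₁, -, hρ', hρ₁, h1, h2, h3, h4, h5, h6, h7, h8, h9, h10, h11, h12, h13⟩ :=
    normalForm_of_chart hρ (hu.mono (ball_subset_ball hρR)) Θ₀ hus hΘ₀p hΘ₀smooth hΘ₀symm_smooth
      hk hb1 hb2 A hA
  exact ⟨k, Θ, ξ, uhat, ρ', ρ₁, hk, hρ', hρ₁, h1, h2, h3, h4, h5, h6, h7, h8, h9, h10, h11, h12, h13⟩

end Literature.Geometry.Symplectic

end
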